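import Summits.QuantumAdvantage.QuantumAdvantage.Theorems.CharDialTokenDialD
import Summits.QuantumAdvantage.QuantumAdvantage.Theorems.CharDialTokenDialB
import Mathlib.Analysis.SpecificLimits.Normed
import HarnessLib

/-!
# CharDial tower — the TOKEN DIAL, part E: the LOCAL TOKEN DIAL (seventh dial, `K` readers) and the seven-dial residual pieces

Cell `decomp-qadv`, lens 6 («barrier-complement carving»), generation 19 (REV1); supports the LOW child `JLinLowResidual5`
(stmt-QuantumAdvantage-27206) and the HIGH child `JLinResidualHigh5` (27207) of `WalkHardFJLinOdd` (32604).  Theses-free.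

* `TowerDefs.TokenHypLoc K D` — the LOCAL TOKEN hypothesis: some adjacent pair `(s, t = s+1)` is dead for all but at most `K`
  READER cuts, and the RICH SET of the pair (inputs with `u_s ≠ u_t`, every cut other than cut `t` inert under the transposition,
  cut `t` accepting before or after) has size `≥ 2ⁿ/(4p)`.  `TokenHyp D → TokenHypLoc K D` for every `K` (`tokenHypLoc_of_tokenHyp`).
* ★ `tokenLoc_hard K` — THE SEVENTH DECIDED DIAL: for every prime `p ≠ 3` and every `K`, eventually in `n`, a `log₂ n`-junta ⊕ form
  presentation meeting `TokenHypLoc K` wins on `≤ (1 − 1/(24p))·2ⁿ` inputs for every residue `c` — part D's `engineLoc` plus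
  `64·p^{K+2}·n^{K+1}·cos(π/(3p))ⁿ → 0` (`eventually_smallK`).
* the seven-dial residual pieces `TowerDefs.LowResidual7Side B K`, `ResidualHigh7Side B K`, `Residual7Side K` (five decided escape
  clauses ∧ `¬ TokenHypLoc K`; the sixth clause `¬ TokenHyp` is implied and dropped) and, for EVERY `K`, the equivalences
  `lowResidual5_iff_lowResidual7`, `residualHigh5_iff_residualHigh7`, `residual5_iff_residual7` (`absorb_tokenLoc`).
0 sorry.  Part F states the junction with the filed items by name and certifies the HIGH⁷ class inhabited.
-/

set_option autoImplicit false

open Finset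

namespace Summit.QuantumAdvantage.AdviceFreeQNC0.JLinPeel

namespace TowerDefs

variable {p n : ℕ}

/-- **the LOCAL TOKEN DIAL hypothesis with `K` readers** on a presentation: some adjacent pair `(s, t = s+1)` is dead (equal form
coefficients, outside the junta) for every cut outside a set `G` of at most `K` cuts, and at least `2ⁿ/(4p)` inputs `u` have
`u_s ≠ u_t`, every cut other than the cut numbered `t` INERT under the transposition of `s, t`, and the cut numbered `t` accepting
`u` or its transpose. -/
def TokenHypLoc (K : ℕ) (D : JLinPeel.JLinData p n) : Prop :=
  ∃ s t : Fin n, t.val = s.val + 1 ∧ ∃ G : Finset (Fin (n + 1)), G.card ≤ K ∧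
    (∀ g, g ∉ G → D.a g s = D.a g t ∧ s ∉ D.J g ∧ t ∉ D.J g) ∧
    2 ^ n ≤ 4 * p * (Finset.univ.filter fun u : Fin n → Bool =>
      u s ≠ u t ∧ (∀ g : Fin (n + 1), g ≠ ⟨t.val, Nat.lt_succ_of_lt t.isLt⟩ →
          D.strat g (SegMove.segCompl u s.val (s.val + 2)) = D.strat g u) ∧
        (D.strat ⟨t.val, Nat.lt_succ_of_lt t.isLt⟩ u = true ∨
          D.strat ⟨t.val, Nat.lt_succ_of_lt t.isLt⟩ (SegMove.segCompl u s.val (s.val + 2)) = true)).card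

/-- **piece RESIDUAL-HIGH⁷ (`K` readers).** `ResidualHigh5Side` with the seventh escape clause `¬ TokenHypLoc K`. -/
def ResidualHigh7Side (B : ℕ → ℕ) (K : ℕ) : Prop :=
  ∀ (p : ℕ) [Fact p.Prime], 5 ≤ p → ∃ θ : ℝ, θ < 1 ∧ ∃ n₀ : ℕ, ∀ n ≥ n₀, ∀ c : ℕ,
    ∀ y : Fin (n + 1) → (Fin n → Bool) → Bool, JLinHyp p n y → ¬ LowVar B n y →
      (∀ D : JLinPeel.JLinData p n, D.strat = y → (∀ g, (D.J g).card ≤ Nat.log 2 n) →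
          ¬ SpanHyp D ∧ ¬ SparseHyp D ∧ ¬ BlockHyp D ∧ ¬ NullHyp D ∧ ¬ MaskHyp D ∧ ¬ TokenHypLoc K D) →
        ((Finset.univ.filter fun u : Fin n → Bool => ringWinU c y u = true).card : ℝ) ≤ θ * (2 : ℝ) ^ n

/-- **piece LOW-RESIDUAL⁷ (`K` readers).** `LowResidual5Side` with the seventh escape clause `¬ TokenHypLoc K`. -/
def LowResidual7Side (B : ℕ → ℕ) (K : ℕ) : Prop :=
  ∀ (p : ℕ) [Fact p.Prime], 5 ≤ p → ∃ θ : ℝ, θ < 1 ∧ ∃ n₀ : ℕ, ∀ n ≥ n₀, ∀ c : ℕ,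
    ∀ y : Fin (n + 1) → (Fin n → Bool) → Bool, JLinHyp p n y → LowVar B n y →
      (∀ D : JLinPeel.JLinData p n, D.strat = y → (∀ g, (D.J g).card ≤ Nat.log 2 n) →
          ¬ SpanHyp D ∧ ¬ SparseHyp D ∧ ¬ BlockHyp D ∧ ¬ NullHyp D ∧ ¬ MaskHyp D ∧ ¬ TokenHypLoc K D) →
        ((Finset.univ.filter fun u : Fin n → Bool => ringWinU c y u = true).card : ℝ) ≤ θ * (2 : ℝ) ^ n

/-- **the SEVEN-DIAL RESIDUAL of T (`K` readers)** (no variation condition). -/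
def Residual7Side (K : ℕ) : Prop :=
  ∀ (p : ℕ) [Fact p.Prime], 5 ≤ p → ∃ θ : ℝ, θ < 1 ∧ ∃ n₀ : ℕ, ∀ n ≥ n₀, ∀ c : ℕ,
    ∀ y : Fin (n + 1) → (Fin n → Bool) → Bool, JLinHyp p n y →
      (∀ D : JLinPeel.JLinData p n, D.strat = y → (∀ g, (D.J g).card ≤ Nat.log 2 n) →
          ¬ SpanHyp D ∧ ¬ SparseHyp D ∧ ¬ BlockHyp D ∧ ¬ NullHyp D ∧ ¬ MaskHyp D ∧ ¬ TokenHypLoc K D) →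
        ((Finset.univ.filter fun u : Fin n → Bool => ringWinU c y u = true).card : ℝ) ≤ θ * (2 : ℝ) ^ n

end TowerDefs

namespace TokenDial

open SegMove

variable {n : ℕ}

/-! ### the asymptotic input -/

/-- **eventually `64·p^{K+2}·n^{K+1}·cos(π/(3p))ⁿ ≤ 1`.** -/
theorem eventually_smallK (p : ℕ) (hp : 1 ≤ p) (K : ℕ) :
    ∃ n₀ : ℕ, ∀ n ≥ n₀, 64 * (p : ℝ) ^ (K + 2) * (n : ℝ) ^ (K + 1) * Real.cos (Real.pi / (3 * p)) ^ n ≤ 1 := by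
  obtain ⟨hc0, hc1⟩ := cos_facts hp
  have ht := tendsto_pow_const_mul_const_pow_of_lt_one (K + 1) hc0 hc1
  have hp0 : (0 : ℝ) < 64 * (p : ℝ) ^ (K + 2) := by
    have : (1 : ℝ) ≤ p := by exact_mod_cast hp
    positivity
  have hε : (0 : ℝ) < 1 / (64 * (p : ℝ) ^ (K + 2)) := by positivity
  have hev := ht.eventually (gt_mem_nhds hε)
  rw [Filter.eventually_atTop] at hev
  obtain ⟨n₀, hn₀⟩ := hev
  refine ⟨n₀, fun n hn => ?_⟩
  have h := (hn₀ n hn).le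
  calc 64 * (p : ℝ) ^ (K + 2) * (n : ℝ) ^ (K + 1) * Real.cos (Real.pi / (3 * p)) ^ n
      = 64 * (p : ℝ) ^ (K + 2) * ((n : ℝ) ^ (K + 1) * Real.cos (Real.pi / (3 * p)) ^ n) := by ring
    _ ≤ 64 * (p : ℝ) ^ (K + 2) * (1 / (64 * (p : ℝ) ^ (K + 2))) := mul_le_mul_of_nonneg_left h hp0.le
    _ = 1 := by field_simp

/-! ### the dial theorem -/

section Dial

variable {p : ℕ} [hp : Fact p.Prime]

omit hp in
/-- the rich set of `TokenHypLoc` is `richLoc` (the cut index `⟨t.val, _⟩` is `cut t` by `rfl`). -/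
theorem richLoc_eq (D : JLinPeel.JLinData p n) (s t : Fin n) :
    (univ.filter fun u : Fin n → Bool =>
      u s ≠ u t ∧ (∀ g : Fin (n + 1), g ≠ ⟨t.val, Nat.lt_succ_of_lt t.isLt⟩ →
          D.strat g (segCompl u s.val (s.val + 2)) = D.strat g u) ∧
        (D.strat ⟨t.val, Nat.lt_succ_of_lt t.isLt⟩ u = true ∨
          D.strat ⟨t.val, Nat.lt_succ_of_lt t.isLt⟩ (segCompl u s.val (s.val + 2)) = true)) = richLoc D.strat s t := rfl

omit hp in
/-- the dead case is the readerless case: `TokenHyp → TokenHypLoc K` for every `K`. -/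
theorem tokenHypLoc_of_tokenHyp (K : ℕ) (D : JLinPeel.JLinData p n) : TowerDefs.TokenHyp D → TowerDefs.TokenHypLoc K D := by
  rintro ⟨s, t, hst, hdead, hrich⟩
  refine ⟨s, t, hst, ∅, by simp, fun g _ => hdead g, ?_⟩
  rw [richLoc_eq]
  refine hrich.trans (Nat.mul_le_mul_left _ (card_le_card ?_))
  exact rset_subset_richLoc D s t hst hdead

/-- ★ **THE LOCAL TOKEN DIAL (seventh decided dial).** for every prime `p ≠ 3` and every `K`, eventually in `n`: a `log₂ n`-junta ⊕
form presentation meeting `TokenHypLoc K` wins on at most `(1 − 1/(24p))·2ⁿ` inputs, for every residue `c`. -/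
theorem tokenLoc_hard (K : ℕ) (hp3 : p ≠ 3) : ∃ n₀ : ℕ, ∀ n ≥ n₀, ∀ (c : ℕ) (D : JLinPeel.JLinData p n),
    (∀ g, (D.J g).card ≤ Nat.log 2 n) → TowerDefs.TokenHypLoc K D →
      ((univ.filter fun u : Fin n → Bool => ringWinU c D.strat u = true).card : ℝ)
        ≤ (1 - 1 / (24 * p)) * (2 : ℝ) ^ n := by
  have hp1 : 1 ≤ p := hp.out.one_lt.le
  obtain ⟨n₀, hn₀⟩ := eventually_smallK p hp1 K
  refine ⟨max n₀ 1, fun n hn c D hJ hT => ?_⟩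
  have hn1 : 1 ≤ n := le_trans (le_max_right _ _) hn
  obtain ⟨s, t, hst, G, hGK, hdead, hrich⟩ := hT
  rw [richLoc_eq] at hrich
  have hE := engineLoc hp3 c D s t hst G hdead
  have hsmall := hn₀ n (le_trans (le_max_left _ _) hn)
  obtain ⟨hc0, -⟩ := cos_facts hp1
  have hpR : (1 : ℝ) ≤ p := by exact_mod_cast hp1
  -- sizes
  have hG' : (insert (cut t) G).card ≤ K + 1 := (card_insert_le _ _).trans (by omega)
  have hsumJ : ∑ g ∈ insert (cut t) G, (D.J g).card ≤ (K + 1) * Nat.log 2 n := by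
    refine (sum_le_card_nsmul _ _ _ fun g _ => hJ g).trans ?_
    rw [smul_eq_mul]
    exact Nat.mul_le_mul_right _ hG'
  have h2J : (2 : ℝ) ^ (∑ g ∈ insert (cut t) G, (D.J g).card) ≤ (n : ℝ) ^ (K + 1) := by
    have h1 : 2 ^ (∑ g ∈ insert (cut t) G, (D.J g).card) ≤ 2 ^ ((K + 1) * Nat.log 2 n) :=
      Nat.pow_le_pow_right (by norm_num) hsumJ
    have h2 : 2 ^ ((K + 1) * Nat.log 2 n) ≤ n ^ (K + 1) := by
      rw [mul_comm, pow_mul]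
      exact Nat.pow_le_pow_left (Nat.pow_log_le_self 2 (by omega)) _
    exact_mod_cast h1.trans h2
  have hpG : (p : ℝ) ^ (insert (cut t) G).card ≤ (p : ℝ) ^ (K + 1) := pow_le_pow_right₀ hpR hG'
  -- the richness, in ℝ
  have hR : (2 : ℝ) ^ n ≤ 4 * p * ((richLoc D.strat s t).card : ℝ) := by exact_mod_cast hrich
  -- the error term
  have hcn : 0 ≤ Real.cos (Real.pi / (3 * p)) ^ n := pow_nonneg hc0 n
  have herr : 8 * (p : ℝ) ^ (insert (cut t) G).card * (2 : ℝ) ^ (∑ g ∈ insert (cut t) G, (D.J g).card)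
      * (2 * Real.cos (Real.pi / (3 * p))) ^ n ≤ (2 : ℝ) ^ n / (8 * p) := by
    rw [mul_pow, le_div_iff₀ (by positivity)]
    have hA : (p : ℝ) ^ (insert (cut t) G).card * (2 : ℝ) ^ (∑ g ∈ insert (cut t) G, (D.J g).card)
        ≤ (p : ℝ) ^ (K + 1) * (n : ℝ) ^ (K + 1) := mul_le_mul hpG h2J (by positivity) (by positivity)
    have h3 : (0 : ℝ) ≤ 2 ^ n := by positivity
    calc 8 * (p : ℝ) ^ (insert (cut t) G).card * (2 : ℝ) ^ (∑ g ∈ insert (cut t) G, (D.J g).card)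
          * ((2 : ℝ) ^ n * Real.cos (Real.pi / (3 * p)) ^ n) * (8 * p)
        = 64 * (p : ℝ) * ((p : ℝ) ^ (insert (cut t) G).card * (2 : ℝ) ^ (∑ g ∈ insert (cut t) G, (D.J g).card))
          * Real.cos (Real.pi / (3 * p)) ^ n * 2 ^ n := by ring
      _ ≤ 64 * (p : ℝ) * ((p : ℝ) ^ (K + 1) * (n : ℝ) ^ (K + 1)) * Real.cos (Real.pi / (3 * p)) ^ n * 2 ^ n := by
          gcongr
      _ = (64 * (p : ℝ) ^ (K + 2) * (n : ℝ) ^ (K + 1) * Real.cos (Real.pi / (3 * p)) ^ n) * 2 ^ n := by ring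
      _ ≤ 1 * 2 ^ n := mul_le_mul_of_nonneg_right hsmall h3
      _ = (2 : ℝ) ^ n := one_mul _
  have hp0 : (0 : ℝ) < p := by linarith
  have key : 3 * ((univ.filter fun u : Fin n → Bool => ringWinU c D.strat u = true).card : ℝ)
      ≤ 3 * (2 : ℝ) ^ n - (2 : ℝ) ^ n / (4 * p) + (2 : ℝ) ^ n / (8 * p) := by
    have h4 : (2 : ℝ) ^ n / (4 * p) ≤ ((richLoc D.strat s t).card : ℝ) := by
      rw [div_le_iff₀ (by positivity)]; linarith
    linarith
  have h5 : 3 * (2 : ℝ) ^ n - (2 : ℝ) ^ n / (4 * p) + (2 : ℝ) ^ n / (8 * p) = 3 * ((1 - 1 / (24 * p)) * (2 : ℝ) ^ n) := by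
    field_simp; ring
  linarith

end Dial

/-! ### the seventh escape clause: each five-dial piece is EQUIVALENT to its seven-dial residual, every `K` -/

section Junction

/-- class⁷ ⊆ class⁵: the five-dial pieces give the seven-dial pieces. -/
theorem residual7_of_residual5 (K : ℕ) : TowerDefs.Residual5Side → TowerDefs.Residual7Side K := by
  intro h p _ hp5
  obtain ⟨θ, hθ, n₀, hn₀⟩ := h p hp5
  exact ⟨θ, hθ, n₀, fun n hn c y hy hesc => hn₀ n hn c y hy fun D hD hJ =>
    let ⟨h1, h2, h3, h4, h5, _⟩ := hesc D hD hJ; ⟨h1, h2, h3, h4, h5⟩⟩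

/-- class⁷ ⊆ class⁵ on the LOW side. -/
theorem lowResidual7_of_lowResidual5 (B : ℕ → ℕ) (K : ℕ) :
    TowerDefs.LowResidual5Side B → TowerDefs.LowResidual7Side B K := by
  intro h p _ hp5
  obtain ⟨θ, hθ, n₀, hn₀⟩ := h p hp5
  exact ⟨θ, hθ, n₀, fun n hn c y hy hV hesc => hn₀ n hn c y hy hV fun D hD hJ =>
    let ⟨h1, h2, h3, h4, h5, _⟩ := hesc D hD hJ; ⟨h1, h2, h3, h4, h5⟩⟩

/-- class⁷ ⊆ class⁵ on the HIGH side. -/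
theorem residualHigh7_of_residualHigh5 (B : ℕ → ℕ) (K : ℕ) :
    TowerDefs.ResidualHigh5Side B → TowerDefs.ResidualHigh7Side B K := by
  intro h p _ hp5
  obtain ⟨θ, hθ, n₀, hn₀⟩ := h p hp5
  exact ⟨θ, hθ, n₀, fun n hn c y hy hV hesc => hn₀ n hn c y hy hV fun D hD hJ =>
    let ⟨h1, h2, h3, h4, h5, _⟩ := hesc D hD hJ; ⟨h1, h2, h3, h4, h5⟩⟩

/-- **absorbing the local token dial** (the common step): under a side condition `V` on the strategy, the seven-dial residual
piece gives the five-dial piece, with `θ := max θ₇ (1 − 1/(24p))`. -/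
theorem absorb_tokenLoc (V : (p n : ℕ) → (Fin (n + 1) → (Fin n → Bool) → Bool) → Prop) (K : ℕ)
    (h7 : ∀ (p : ℕ) [Fact p.Prime], 5 ≤ p → ∃ θ : ℝ, θ < 1 ∧ ∃ n₀ : ℕ, ∀ n ≥ n₀, ∀ c : ℕ,
      ∀ y : Fin (n + 1) → (Fin n → Bool) → Bool, TowerDefs.JLinHyp p n y → V p n y →
        (∀ D : JLinPeel.JLinData p n, D.strat = y → (∀ g, (D.J g).card ≤ Nat.log 2 n) →
            ¬ TowerDefs.SpanHyp D ∧ ¬ TowerDefs.SparseHyp D ∧ ¬ TowerDefs.BlockHyp D ∧ ¬ TowerDefs.NullHyp D ∧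
              ¬ TowerDefs.MaskHyp D ∧ ¬ TowerDefs.TokenHypLoc K D) →
          ((Finset.univ.filter fun u : Fin n → Bool => ringWinU c y u = true).card : ℝ) ≤ θ * (2 : ℝ) ^ n) :
    ∀ (p : ℕ) [Fact p.Prime], 5 ≤ p → ∃ θ : ℝ, θ < 1 ∧ ∃ n₀ : ℕ, ∀ n ≥ n₀, ∀ c : ℕ,
      ∀ y : Fin (n + 1) → (Fin n → Bool) → Bool, TowerDefs.JLinHyp p n y → V p n y →
        (∀ D : JLinPeel.JLinData p n, D.strat = y → (∀ g, (D.J g).card ≤ Nat.log 2 n) →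
            ¬ TowerDefs.SpanHyp D ∧ ¬ TowerDefs.SparseHyp D ∧ ¬ TowerDefs.BlockHyp D ∧ ¬ TowerDefs.NullHyp D ∧
              ¬ TowerDefs.MaskHyp D) →
          ((Finset.univ.filter fun u : Fin n → Bool => ringWinU c y u = true).card : ℝ) ≤ θ * (2 : ℝ) ^ n := by
  intro p _ hp5
  have hp3 : p ≠ 3 := by omega
  obtain ⟨θ, hθ, n₇, hn₇⟩ := h7 p hp5
  obtain ⟨n₁, hn₁⟩ := tokenLoc_hard (p := p) K hp3
  have hpR : (0 : ℝ) < p := by exact_mod_cast (show 0 < p by omega)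
  have hθ' : (1 : ℝ) - 1 / (24 * p) < 1 := by
    have : (0 : ℝ) < 1 / (24 * p) := by positivity
    linarith
  refine ⟨max θ (1 - 1 / (24 * p)), max_lt hθ hθ', max n₇ n₁, fun n hn c y hy hV hesc => ?_⟩
  have h2n : (0 : ℝ) ≤ (2 : ℝ) ^ n := by positivity
  by_cases htok : ∃ D : JLinPeel.JLinData p n, D.strat = y ∧ (∀ g, (D.J g).card ≤ Nat.log 2 n) ∧ TowerDefs.TokenHypLoc K D
  · obtain ⟨D, hD, hJ, hT⟩ := htok
    have h := hn₁ n (le_trans (le_max_right _ _) hn) c D hJ hT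
    rw [hD] at h
    exact h.trans (mul_le_mul_of_nonneg_right (le_max_right _ _) h2n)
  · push Not at htok
    have h := hn₇ n (le_trans (le_max_left _ _) hn) c y hy hV fun D hD hJ =>
      let ⟨h1, h2, h3, h4, h5⟩ := hesc D hD hJ; ⟨h1, h2, h3, h4, h5, htok D hD hJ⟩
    exact h.trans (mul_le_mul_of_nonneg_right (le_max_left _ _) h2n)

/-- ★ the seven-dial residual gives the five-dial residual (local token dial absorbed), every `K`. -/
theorem residual5_of_residual7 (K : ℕ) : TowerDefs.Residual7Side K → TowerDefs.Residual5Side := by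
  intro h7
  have h := absorb_tokenLoc (fun _ _ _ => True) K (fun p _ hp5 => by
    obtain ⟨θ, hθ, n₀, hn₀⟩ := h7 p hp5
    exact ⟨θ, hθ, n₀, fun n hn c y hy _ hesc => hn₀ n hn c y hy hesc⟩)
  intro p _ hp5
  obtain ⟨θ, hθ, n₀, hn₀⟩ := h p hp5
  exact ⟨θ, hθ, n₀, fun n hn c y hy hesc => hn₀ n hn c y hy trivial hesc⟩

/-- ★ LOW-RESIDUAL⁷ gives LOW-RESIDUAL⁵ (local token dial absorbed), every schedule `B`, every `K`. -/
theorem lowResidual5_of_lowResidual7 (B : ℕ → ℕ) (K : ℕ) :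
    TowerDefs.LowResidual7Side B K → TowerDefs.LowResidual5Side B :=
  fun h7 => absorb_tokenLoc (fun _ n y => TowerDefs.LowVar B n y) K h7

/-- ★ RESIDUAL-HIGH⁷ gives RESIDUAL-HIGH⁵ (local token dial absorbed), every schedule `B`, every `K`. -/
theorem residualHigh5_of_residualHigh7 (B : ℕ → ℕ) (K : ℕ) :
    TowerDefs.ResidualHigh7Side B K → TowerDefs.ResidualHigh5Side B :=
  fun h7 => absorb_tokenLoc (fun _ n y => ¬ TowerDefs.LowVar B n y) K h7

/-- ★★ RESIDUAL⁵ ⟺ RESIDUAL⁷(K), every `K`. -/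
theorem residual5_iff_residual7 (K : ℕ) : TowerDefs.Residual5Side ↔ TowerDefs.Residual7Side K :=
  ⟨residual7_of_residual5 K, residual5_of_residual7 K⟩

/-- ★★ LOW-RESIDUAL⁵ ⟺ LOW-RESIDUAL⁷(K), every schedule `B`, every `K`. -/
theorem lowResidual5_iff_lowResidual7 (B : ℕ → ℕ) (K : ℕ) :
    TowerDefs.LowResidual5Side B ↔ TowerDefs.LowResidual7Side B K :=
  ⟨lowResidual7_of_lowResidual5 B K, lowResidual5_of_lowResidual7 B K⟩

/-- ★★ RESIDUAL-HIGH⁵ ⟺ RESIDUAL-HIGH⁷(K), every schedule `B`, every `K`. -/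
theorem residualHigh5_iff_residualHigh7 (B : ℕ → ℕ) (K : ℕ) :
    TowerDefs.ResidualHigh5Side B ↔ TowerDefs.ResidualHigh7Side B K :=
  ⟨residualHigh7_of_residualHigh5 B K, residualHigh5_of_residualHigh7 B K⟩

/-- ★ LOW-RESIDUAL⁶ ⟺ LOW-RESIDUAL⁷(K) (through LOW-RESIDUAL⁵), every `B`, `K`. -/
theorem lowResidual6_iff_lowResidual7 (B : ℕ → ℕ) (K : ℕ) :
    TowerDefs.LowResidual6Side B ↔ TowerDefs.LowResidual7Side B K :=
  (lowResidual5_iff_lowResidual6 B).symm.trans (lowResidual5_iff_lowResidual7 B K)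

/-- ★ RESIDUAL-HIGH⁶ ⟺ RESIDUAL-HIGH⁷(K) (through RESIDUAL-HIGH⁵), every `B`, `K`. -/
theorem residualHigh6_iff_residualHigh7 (B : ℕ → ℕ) (K : ℕ) :
    TowerDefs.ResidualHigh6Side B ↔ TowerDefs.ResidualHigh7Side B K :=
  (residualHigh5_iff_residualHigh6 B).symm.trans (residualHigh5_iff_residualHigh7 B K)

end Junction

end TokenDial

end Summit.QuantumAdvantage.AdviceFreeQNC0.JLinPeel
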